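import Summits.Ventures.PercRepro0.Pivotal
import Summits.Ventures.PercRepro0.TwoPoint

/-!
# Disjoint occurrence and the pivotal decomposition (seat p4, block-M census supplement, part 1 of R_MID-6)

Part 1 of the Lean twin of R_MID-6 · INTEGRATED-BUBBLE (PLAN-plan-1-v4 §3; census v5 §3.2) on `Defs`.

* `cyl K ω` = the cylinder `[ω]_K` of a finite bond set `K`; `DisjOcc A B` = the disjoint occurrence `A ∘ B`
  (two disjoint finite bond sets, one certifying `A`, one certifying `B` — the object of Aizenman–Barsky
  Prop. 3.4 / Hara–Slade (1.33));
* **`BK d`** = P10 · BK-INCREASING in the form used here: `P_p(A ∘ B) ≤ P_p(A) P_p(B)` for increasing events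
  `A`, `B` determined by one finite bond set. `BK d` is a NAMED HYPOTHESIS of everything downstream
  (`P_piv_le`, and `Bubble.T_of_integrable_bubble`); it is NOT proved in this module or its successor —
  P10 is PUBLISHED-HELD in the route (lead ruling 00:30:27Z), and a kernel proof, if any lands, discharges
  the hypothesis by a one-line corollary;
* `boxConn_iff_connIn`: the finite-volume event `{x ↔_{Λ_n} y}` of ContinuityCoupling is the `ConnIn (box d n)`
  event of ClusterS (so Russo's formula and the walk characterisation both apply to it);
* **`piv_subset_disjOcc`**: if `s(u,v)` is pivotal for `{0 ↔_{Λ_n} x}` then the configuration carries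
  edge-disjoint open paths `0 → u` and `v → x` inside `Λ_n` (or `0 → v` and `u → x`) — the open path through
  the pivotal bond, taken simple and split at that bond (`exists_split`, `split_nodup`);
* **`P_piv_le`** (given `BK d`): `P_p(s(u,v) pivotal) ≤ τ_p(0,u) τ_p(v,x) + τ_p(0,v) τ_p(u,x)`.

Census evidence only, off every declaration path; nothing claimed on `T(d)` for any `d`.
-/

namespace Summit.Ventures.PercRepro0.Bubble

open MeasureTheory ProbabilityTheory unitInterval Set Filter
open Summit.Ventures.PercRepro0.Defs
open Summit.Ventures.PercRepro0.Sharp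
open scoped ENNReal NNReal Topology Classical

variable {d : ℕ}

/-! ### Cylinders, disjoint occurrence, the BK hypothesis -/

/-- The cylinder `[ω]_K`: configurations agreeing with `ω` on the finite bond set `K`. -/
def cyl (K : Finset (Sym2 (Vertex d))) (ω : Config d) : Set (Config d) :=
  {ω' | ∀ e ∈ K, (e ∈ ω' ↔ e ∈ ω)}

/-- `ω ∈ [ω]_K`. -/
theorem mem_cyl_self (K : Finset (Sym2 (Vertex d))) (ω : Config d) : ω ∈ cyl K ω := fun _ _ => Iff.rfl

/-- Disjoint occurrence `A ∘ B`: `ω` carries two disjoint finite sets of bonds, one certifying `A`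
and one certifying `B` (the object of the BK inequality, Aizenman–Barsky Prop. 3.4 / Hara–Slade (1.33)). -/
def DisjOcc (A B : Set (Config d)) : Set (Config d) :=
  {ω | ∃ K L : Finset (Sym2 (Vertex d)), Disjoint K L ∧ cyl K ω ⊆ A ∧ cyl L ω ⊆ B}

/-- **P10 · BK** in the form used here, as a named hypothesis (never proved in this module): for every
finite bond set `E` and increasing `E`-determined events `A`, `B`, `P_p(A ∘ B) ≤ P_p(A) P_p(B)`. -/
def BK (d : ℕ) : Prop :=
  ∀ (p : I) (E : Finset (Sym2 (Vertex d))), (↑E : Set (Sym2 (Vertex d))) ⊆ bonds d →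
    ∀ A B : Set (Config d), IsUpperSet A → IsUpperSet B →
      DeterminedBy (↑E) A → DeterminedBy (↑E) B → P d p (DisjOcc A B) ≤ P d p A * P d p B

/-! ### Splitting a walk at an edge -/

/-- A walk containing the edge `e` splits as `w₁ ++ e ++ w₂` with `s(a, b) = e`. -/
theorem exists_split {V : Type*} {G : SimpleGraph V} :
    ∀ {s t : V} (w : G.Walk s t) {e : Sym2 V}, e ∈ w.edges →
      ∃ (a b : V) (w₁ : G.Walk s a) (w₂ : G.Walk b t), s(a, b) = e ∧ w.edges = w₁.edges ++ e :: w₂.edges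
  | _, _, SimpleGraph.Walk.nil, e, he => by simp at he
  | s, t, SimpleGraph.Walk.cons (v := v) h w', e, he => by
    rw [SimpleGraph.Walk.edges_cons, List.mem_cons] at he
    rcases he with rfl | he
    · exact ⟨s, v, SimpleGraph.Walk.nil, w', rfl, by simp⟩
    · obtain ⟨a, b, w₁, w₂, hab, hed⟩ := exists_split w' he
      exact ⟨a, b, SimpleGraph.Walk.cons h w₁, w₂, hab, by simp [hed]⟩

/-- In a walk with no repeated edge that splits as `w₁ ++ e ++ w₂`, `e` is in neither piece and the
pieces are edge-disjoint. -/
theorem split_nodup {V : Type*} {G : SimpleGraph V} {s a b t : V} {w : G.Walk s t} (hw : w.edges.Nodup)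
    {e : Sym2 V} {w₁ : G.Walk s a} {w₂ : G.Walk b t} (hed : w.edges = w₁.edges ++ e :: w₂.edges) :
    e ∉ w₁.edges ∧ e ∉ w₂.edges ∧ ∀ f ∈ w₁.edges, f ∉ w₂.edges := by
  rw [hed, List.nodup_append] at hw
  obtain ⟨_, h2, h3⟩ := hw
  rw [List.nodup_cons] at h2
  refine ⟨fun h => h3 e h e List.mem_cons_self rfl, h2.1,
    fun f hf hf' => h3 f hf f (List.mem_cons_of_mem _ hf') rfl⟩

/-! ### The finite-volume two-point function `τ^n` as `ConnIn` -/

/-- `{x ↔_{Λ_n} y}` (`boxConn`, ContinuityCoupling) is the `ConnIn (box d n)` event of ClusterS. -/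
theorem boxConn_iff_connIn (n : ℕ) (ω : Config d) (x y : Vertex d) :
    ω ∈ boxConn d n x y ↔ ConnIn (box d n) ω x y := by
  show Conn d (ω ∩ boxBonds d n) x y ↔ ConnIn (box d n) ω x y
  unfold Conn ConnIn
  have h : openGraph d (ω ∩ boxBonds d n) = inGraph (box d n) ω := by
    unfold openGraph inGraph
    congr 1
    ext e
    simp only [Set.mem_inter_iff, boxBonds, bondsIn, Set.mem_setOf_eq]
    tauto
  rw [h]

/-- The same, as sets. -/
theorem boxConn_eq_connIn (n : ℕ) (x y : Vertex d) :
    boxConn d n x y = {ω : Config d | ConnIn (box d n) ω x y} :=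
  Set.ext fun ω => boxConn_iff_connIn n ω x y

/-- `{x ↔_{Λ_n} y}` is determined by the bonds of `Λ_n`. -/
theorem determinedBy_boxConn_boxBondsF (n : ℕ) (x y : Vertex d) :
    DeterminedBy (↑(boxBondsF d n)) (boxConn d n x y) := by
  rw [coe_boxBondsF, boxConn_eq_connIn]
  exact determinedBy_connIn _ x y

/-- `{x ↔_{Λ_n} y}` is increasing. -/
theorem isUpperSet_boxConn (n : ℕ) (x y : Vertex d) : IsUpperSet (boxConn d n x y) :=
  fun _ _ h hω => conn_mono (Set.inter_subset_inter_left _ h) hω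

/-- `{x ↔_{Λ_n} y} ⊆ {x ↔ y}`. -/
theorem boxConn_subset_conn (n : ℕ) (x y : Vertex d) :
    boxConn d n x y ⊆ {ω : Config d | Conn d ω x y} :=
  fun _ hω => conn_mono Set.inter_subset_left hω

/-- `P_p(x ↔_{Λ_n} y) ≤ τ_p(x,y)` (measure form). -/
theorem P_boxConn_le (p : I) (n : ℕ) (x y : Vertex d) :
    P d p (boxConn d n x y) ≤ P d p {ω : Config d | Conn d ω x y} :=
  measure_mono (boxConn_subset_conn n x y)

/-! ### The pivotal decomposition -/

/-- If `s(u,v)` is pivotal for `{0 ↔_{Λ_n} x}` in `ω`, then `ω` carries edge-disjoint open paths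
`0 → u` and `v → x` inside `Λ_n` (or `0 → v` and `u → x`): the path through the pivotal bond, split at it. -/
theorem piv_subset_disjOcc (n : ℕ) (x u v : Vertex d) :
    Russo.Piv s(u, v) (boxConn d n 0 x) ⊆
      DisjOcc (boxConn d n 0 u) (boxConn d n v x) ∪ DisjOcc (boxConn d n 0 v) (boxConn d n u x) := by
  rintro ω ⟨h1, h2⟩
  rw [boxConn_iff_connIn, connIn_iff_exists_walk] at h1
  obtain ⟨w, hw⟩ := h1
  set q : (lattice d).Walk 0 x := (w.toPath : (lattice d).Walk 0 x) with hq
  have hqe : ∀ f ∈ q.edges, f ∈ insert s(u, v) ω ∧ f ∈ bondsIn (box d n) :=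
    fun f hf => hw f (SimpleGraph.Walk.edges_toPath_subset_edges w hf)
  have hnodup : q.edges.Nodup :=
    SimpleGraph.Walk.edges_nodup_of_support_nodup w.toPath.2.support_nodup
  have he : s(u, v) ∈ q.edges := by
    by_contra he
    apply h2
    rw [boxConn_iff_connIn, connIn_iff_exists_walk]
    refine ⟨q, fun f hf => ⟨?_, (hqe f hf).2⟩⟩
    have hf' := (hqe f hf).1
    rw [Set.mem_insert_iff] at hf'
    rcases hf' with rfl | hf'
    · exact absurd hf he
    · exact ⟨hf', fun hfe => he (Set.mem_singleton_iff.1 hfe ▸ hf)⟩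
  obtain ⟨a, b, w₁, w₂, hab, hed⟩ := exists_split q he
  obtain ⟨he1, he2, hdisj⟩ := split_nodup hnodup hed
  have hsub1 : ∀ f ∈ w₁.edges, f ∈ q.edges := fun f hf => by
    rw [hed]; exact List.mem_append_left _ hf
  have hsub2 : ∀ f ∈ w₂.edges, f ∈ q.edges := fun f hf => by
    rw [hed]; exact List.mem_append_right _ (List.mem_cons_of_mem _ hf)
  have hω1 : ∀ f ∈ w₁.edges, f ∈ ω := fun f hf => by
    have h := (hqe f (hsub1 f hf)).1
    rw [Set.mem_insert_iff] at h
    rcases h with rfl | h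
    · exact absurd hf he1
    · exact h
  have hω2 : ∀ f ∈ w₂.edges, f ∈ ω := fun f hf => by
    have h := (hqe f (hsub2 f hf)).1
    rw [Set.mem_insert_iff] at h
    rcases h with rfl | h
    · exact absurd hf he2
    · exact h
  have hK : cyl w₁.edges.toFinset ω ⊆ boxConn d n 0 a := fun ω' hω' => by
    rw [boxConn_iff_connIn, connIn_iff_exists_walk]
    exact ⟨w₁, fun f hf => ⟨(hω' f (List.mem_toFinset.2 hf)).2 (hω1 f hf), (hqe f (hsub1 f hf)).2⟩⟩
  have hL : cyl w₂.edges.toFinset ω ⊆ boxConn d n b x := fun ω' hω' => by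
    rw [boxConn_iff_connIn, connIn_iff_exists_walk]
    exact ⟨w₂, fun f hf => ⟨(hω' f (List.mem_toFinset.2 hf)).2 (hω2 f hf), (hqe f (hsub2 f hf)).2⟩⟩
  have hKL : Disjoint w₁.edges.toFinset w₂.edges.toFinset := by
    rw [Finset.disjoint_left]
    intro f hf hf'
    exact hdisj f (List.mem_toFinset.1 hf) (List.mem_toFinset.1 hf')
  rw [Sym2.eq_iff] at hab
  rcases hab with ⟨rfl, rfl⟩ | ⟨rfl, rfl⟩
  · exact Or.inl ⟨_, _, hKL, hK, hL⟩
  · exact Or.inr ⟨_, _, hKL, hK, hL⟩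

/-- **The pivotal bound** (given BK): `P_p(s(u,v) pivotal for {0 ↔_{Λ_n} x}) ≤ τ(0,u) τ(v,x) + τ(0,v) τ(u,x)`
(measure form, `τ` the infinite-volume two-point function). -/
theorem P_piv_le (hBK : BK d) (p : I) (n : ℕ) (x u v : Vertex d) :
    P d p (Russo.Piv s(u, v) (boxConn d n 0 x)) ≤
      P d p {ω : Config d | Conn d ω 0 u} * P d p {ω : Config d | Conn d ω v x} +
        P d p {ω : Config d | Conn d ω 0 v} * P d p {ω : Config d | Conn d ω u x} := by
  calc P d p (Russo.Piv s(u, v) (boxConn d n 0 x))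
      ≤ P d p (DisjOcc (boxConn d n 0 u) (boxConn d n v x) ∪
          DisjOcc (boxConn d n 0 v) (boxConn d n u x)) := measure_mono (piv_subset_disjOcc n x u v)
    _ ≤ P d p (DisjOcc (boxConn d n 0 u) (boxConn d n v x)) +
          P d p (DisjOcc (boxConn d n 0 v) (boxConn d n u x)) := measure_union_le _ _
    _ ≤ P d p (boxConn d n 0 u) * P d p (boxConn d n v x) +
          P d p (boxConn d n 0 v) * P d p (boxConn d n u x) :=
        add_le_add
          (hBK p _ (boxBondsF_subset_bonds n) _ _ (isUpperSet_boxConn n 0 u) (isUpperSet_boxConn n v x)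
            (determinedBy_boxConn_boxBondsF n 0 u) (determinedBy_boxConn_boxBondsF n v x))
          (hBK p _ (boxBondsF_subset_bonds n) _ _ (isUpperSet_boxConn n 0 v) (isUpperSet_boxConn n u x)
            (determinedBy_boxConn_boxBondsF n 0 v) (determinedBy_boxConn_boxBondsF n u x))
    _ ≤ _ := add_le_add (mul_le_mul' (P_boxConn_le p n 0 u) (P_boxConn_le p n v x))
          (mul_le_mul' (P_boxConn_le p n 0 v) (P_boxConn_le p n u x))

end Summit.Ventures.PercRepro0.Bubble
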